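import Literature.MathematicalPhysics.QuantumFieldTheory.Balaban1983to89.B9Eq368TowerFiveFactorWordLadder
import Literature.MathematicalPhysics.QuantumFieldTheory.Balaban1983to89.B9Eq365TowerQGGQWordLadder
import Literature.MathematicalPhysics.QuantumFieldTheory.Balaban1983to89.B9Eq325ProjFormulaTower
import Literature.MathematicalPhysics.QuantumFieldTheory.Balaban1983to89.B6DomainMajorant

/-!
# `Balaban1983to89.B9Eq368TowerProjLadder` — T. Bałaban, *Propagators for lattice gauge theories in a background field*, Commun. Math. Phys. **99** (1985) 389–434
# [Balaban1985BackgroundPropagators] (3.68) p. 403 («the operators R(U), P(U) = I − R(U) extend analytically to the domain (3.37) and satisfy the same bounds»), (3.25) p. 394, Thm 3.1 (3.42)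
# p. 397, Thm 3.2 (3.48) p. 398, with [Balaban1984PropagatorsII] (2.51)–(2.55) p. 232, (2.66) p. 234: **THE TWO-BACKGROUND LADDER FOR THE NE9 CHAIN's `k`-LEVEL PROJECTION `R_k(U)`,
# LATTICE-UNIFORMLY, GIVEN THE INVERSE THIRD OPERATOR's ROWS AND LADDER** — by the chain's (3.25) `B9Eq325ProjFormulaTower.RofUk_eq_formula` (`R_k = I − G′_kQ̃′_k†c_kQ̃′_kG′_k`), the readings
# of this lineage (`readA`, `readAHom`, `kerOp k_Q`, `liftOp s_Q`) and the abstract five-factor ladder `B9Eq368TowerFiveFactorWordLadder`, fed by the `G′_k`-ladder (J-10b), the vacuum row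
# (J-10a), the block-diagonal letters (J-14) — the rows `K_c e^{−δ_c d}` and the ladder `K_D·α·e^{−δ_D d}` of `c_k` entering as HYPOTHESES (inhabitants: `B9Eq367TowerQGGQInvLadderClosed` and
# the owner's closed rows through `B9Eq349TowerSiteRowSeam`): **`conj b (readA φ R_k(U)) − conj b (readA φ R_k(1)) ≺ K·α·e^{−δ d}`** over `towerGeom`, constants BEFORE `n, η, m, U`

statement-level skeleton of published theorems with citation tags; proofs where landed; nothing here is a claim about the Yang–Mills mass gap

CITATION HEADER (lean-in-tree rule).  Audit cell `pub-balaban`, sub-cell `t4`, BINDER row NE9; NE9 crux-team LEAF PROVER 01 (`b2b-balaban-t4-ne9-formalise-leaf-01`,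
gen 99; bears_on: R4/N22).  Vocabulary BY NAME: the OWNER's `B9Eq325ProjFormulaTower.RofUk_eq_formula` ∕ `QGGQk_pos`, `B9Eq326OperatorTower.RofUk`, `B9Eq310HessianHermitian.adTransportW_adjoint`,
`B11Eq103H1Complex.greenK`; this lineage's `B9Eq368TowerFiveFactorWordLadder.hasMajorant_word5_sub_word5`, `B9Eq365TowerQGGQWordLadder.readAHom_comp` ∕ `readAHom_eq_readA`,
`B9Eq319QprimeTowerHomMajorants` (identifications), `B9Eq365TowerXOperatorLadder` (block-diagonal letters), `B9Thm34TowerVacuumLadder`, `B9Eq342TowerFlatBaseMajorants`, `B9Eq358TowerKernelSizes`,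
`B9Eq324PenaltyKernelForm`, `B9Eq357QprimeTowerKernelForm`, `B9Eq360LaplacePrimeAkLaw.conj_one`, `B6DomainMajorant.hasMajorant_neg`, r06's `conj` ∕ `conjHom`, pv08's `HasMajorant(Hom)`.  Sources
read through those files' verbatim quotations: [Balaban1985BackgroundPropagators] pp. 394, 397–398, 403; [Balaban1984PropagatorsII] pp. 232, 234.  [folklore] COMPOSITION BY NAME; NOTHING
of print's proofs is reproduced beyond what the named files prove.

WHAT IS PROVED (sorry-free; proof lane — no `def`).
* **`conj_readA_RofUk_eq`** — `conj b (readA φ R_k(U)) = 1 − E ∘ S ∘ c ∘ A ∘ E` with the realified letters `E = conj b (readA φ G′_k(U))`, `S = conjHom b (liftOp blkK s_Q(U))`,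
  `c = conj b (readA φ c_k(U))`, `A = conjHom b (kerOp blkK k_Q(U))`.
* **`exists_hasMajorant_RofUk_sub_flat`** — given `K_c, δ_c, K_D, δ_D`: `∃ α_R > 0, K ≥ 0, δ > 0` BEFORE the lattice such that on print's small-field class (plus fibre-isometric level
  transporters, unitary `U`), for ANY positivity witnesses, ANY `M, R_r, H`, whenever the inverse third operators at `U` and at `1` have the rows `K_c e^{−δ_c d}` and the ladder
  `K_D·α·e^{−δ_D d}`: `conj b (readA φ R_k(U)) − conj b (readA φ R_k(1)) ≺ K·α·e^{−δ d}`.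
HONEST SCOPE.  Junction ∕ bookkeeping; the `c_k` data are hypotheses here; constants crude (NOT print's); the Thm-3.1 inputs behind the ladders are the cell's MODEL rows («NE9 ⇐ the named
binders»; O-NE9-1, #5 UNRULED); NOT the bond `G_k`, NOT `H̃_{1,k}`, `𝔊̃_k`; NE9 NOT PRINTED ∕ NOT PROVED; spine PROVED 0∕9; rung (B)+1 finite T⁴ — NOT infinite volume, NOT mass gap, NOT
BetaPertH, NOT Clay.  HONEST DEPENDENCY: continuum YM on T⁴ ⇐ BetaPertH ∧ nine spine estimates (0/9 proved); BetaPertH ⇐ (D1) ∧ (D4) ∧ CAP+tail; G-an2-4 gates asym, D1 and NE2/3/4.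
NEW file; nothing modified.  Net new unproved facts: 0.
-/

noncomputable section

open scoped BigOperators InnerProductSpace

namespace Literature.MathematicalPhysics.QuantumFieldTheory.Balaban1983to89.B9Eq368TowerProjLadder

open B4Sect5Torus (TSite)
open B7Prop1Explicit (U1)
open B9SectCLatticeCarrier (Bond shift)
open B9Eq311L2Pairing (WL2)
open B11Eq103H1Complex (SiteL2K greenK)
open B9Eq310HessianOperator (adTransportW)
open B9Eq310HessianHermitian (adTransportW_adjoint)
open B9Eq315QTower (towerP UlevOf)
open B9Eq326OperatorTower (QprimeTowerW RofUk)
open B9Eq33CovDerivVector (adTransport)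
open B9Eq324DeltaPrimeATower (laplacePrimeAk GpOfUk)
open B9Eq325ProjFormulaTower (QGGQk_pos RofUk_eq_formula)
open B6RandomWalk (HasMajorant hasMajorant_mono c1_nonneg)
open B6RandomWalkHom (HasMajorantHom hasMajorantHom_mono)
open B6DomainMajorant (hasMajorant_neg)
open B4Sect5Proof (weaken)
open B9Thm34Ext (toB6)
open B9Eq352DivFormLetters (conj conj_sub)
open B9Eq376POneLetters (conjHom conjHom_sub conjHom_comp conjHom_eq_conj)
open B9Eq360Vprime (kerOp liftOp liftOp_apply)
open B9Eq357QprimeTowerKernelForm (blkK kQ norm_kQ_le kerOp_add_kernel)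
open B9Eq324PenaltyKernelForm (sQ readA readA_sub readA_id norm_sQ_le)
open B9Eq358TowerKernelSizes (kQ_flatLevels_eq norm_kF_le_of_class norm_sF_le_of_class exp_window_sub_one_le)
open B9Eq360LaplacePrimeAkLaw (conj_one)
open B9Eq341TowerBlockGeometry (towerGeom len_towerGeom hdnn_towerGeom)
open B9Eq342TowerFlatBaseMajorants (exists_hasMajorants_GpOfUk_one norm_adTransportW_UlevOf_one_le star_one_eq_inv_one)
open B9Thm34TowerVacuumLadder (exists_hasMajorant_GpOfUk_sub_flat)
open B9Eq319QprimeTowerHomMajorants (readAHom readAHom_Qtilde_eq_kerOp readAHom_adjoint_Qtilde_eq_liftOp)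
open B9Eq365TowerXOperatorLadder (hasMajorantHom_kerOp_ind hasMajorantHom_liftOp_ind)
open B9Eq365TowerQGGQWordLadder (readAHom_comp readAHom_eq_readA)
open B9Eq368TowerFiveFactorWordLadder (hasMajorant_word5_sub_word5)

/-! ## §1 The chain's `R_k(U)` read and realified is `1 −` the five-factor word -/

section Word

variable {d : ℕ} (L : ℕ) [NeZero L] (m : Fin d → ℕ) [∀ i, NeZero (m i)] (n : ℕ)
  {𝔸 : Type*} [NormedRing 𝔸] [NormedAlgebra ℂ 𝔸] [CompleteSpace 𝔸] [NormOneClass 𝔸] [FiniteDimensional ℂ 𝔸]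
  {W : Type*} [NormedAddCommGroup W] [InnerProductSpace ℂ W] [FiniteDimensional ℂ W] (φ : W ≃ₗ[ℂ] 𝔸)
  {c₀ : ℝ} [Fact (0 < c₀)] (η : ℝ) (U : Bond d (towerP L m (n + 1)) → 𝔸ˣ) {c₁ : ℝ} [Fact (0 < c₁)] (a' : ℝ)
  (hRS : ∀ (bd : Bond d (towerP L m (n + 1))) (v u : W), ⟪adTransportW φ U bd v, u⟫_ℂ = ⟪v, adTransportW φ (fun bd => (U bd)⁻¹) bd u⟫_ℂ)
  (hpos' : ∀ x : SiteL2K ℂ d (towerP L m (n + 1)) c₀ W, x ≠ 0 → 0 < RCLike.re ⟪x, laplacePrimeAk L m n φ η U a' (c₁ := c₁) x⟫_ℂ)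
  {ι : Type} [Fintype ι] (b : Module.Basis ι ℝ 𝔸)

omit [NormOneClass 𝔸] in
/-- **`conj b (readA φ R_k(U)) = 1 − E S c A E`** — (3.25) at the chain (`RofUk_eq_formula`) read in `𝔸` and realified, with `E = conj b (readA φ G′_k(U))`, `S = conjHom b (liftOp blkK s_Q(U))`,
`c = conj b (readA φ c_k(U))` (`c_k = greenK (Q̃′G′²Q̃′†)`), `A = conjHom b (kerOp blkK k_Q(U))`. [cite: Balaban1985BackgroundPropagators, (3.25) p.394; Balaban1984PropagatorsII, (2.51)–(2.52) p.232] -/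
theorem conj_readA_RofUk_eq :
    conj b (readA φ (RofUk L m n φ η U (c₀ := c₀))) =
      1 - conj b (readA φ (GpOfUk L m n φ η U a' (c₁ := c₁) hpos')) ∘ₗ (conjHom b (liftOp (blkK L m n) (sQ L m n φ U (c₀ := c₀) (c₁ := c₁))) ∘ₗ
        (conj b (readA φ (greenK _ (QGGQk_pos L m n φ c₀ η U c₁ a' hRS hpos'))) ∘ₗ
          (conjHom b (kerOp (blkK L m n) (kQ L m n (fun j => adTransport (𝕜 := ℂ) (UlevOf L m (n + 1) U j)))) ∘ₗ conj b (readA φ (GpOfUk L m n φ η U a' (c₁ := c₁) hpos'))))) := by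
  have hR : RofUk L m n φ η U (c₀ := c₀) = LinearMap.id -
      GpOfUk L m n φ η U a' (c₁ := c₁) hpos' ∘ₗ (LinearMap.adjoint ((WL2.linearEquiv ℂ ℂ (fun _ : TSite d m => c₁)).symm.toLinearMap ∘ₗ QprimeTowerW L m n φ U (c₀ := c₀)) ∘ₗ
        (greenK _ (QGGQk_pos L m n φ c₀ η U c₁ a' hRS hpos') ∘ₗ (((WL2.linearEquiv ℂ ℂ (fun _ : TSite d m => c₁)).symm.toLinearMap ∘ₗ QprimeTowerW L m n φ U (c₀ := c₀)) ∘ₗ GpOfUk L m n φ η U a' (c₁ := c₁) hpos'))) := by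
    apply LinearMap.ext
    intro f
    rw [RofUk_eq_formula L m n φ c₀ η U c₁ a' hRS hpos' f]
    rfl
  rw [hR, readA_sub, readA_id, conj_sub, conj_one, ← readAHom_eq_readA φ (_ ∘ₗ _), readAHom_comp, readAHom_comp, readAHom_comp, readAHom_comp,
    readAHom_adjoint_Qtilde_eq_liftOp, readAHom_Qtilde_eq_kerOp, readAHom_eq_readA, readAHom_eq_readA, ← conjHom_eq_conj b (_ ∘ₗ _),
    ← conjHom_comp, ← conjHom_comp, ← conjHom_comp, ← conjHom_comp, conjHom_eq_conj, conjHom_eq_conj]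

end Word

/-! ## §2 The ladder for `R_k` -/

section Main

variable {d : ℕ} (L : ℕ) [NeZero L] {𝔸 : Type*} [NormedRing 𝔸] [NormedAlgebra ℂ 𝔸] [CompleteSpace 𝔸] [NormOneClass 𝔸] [StarRing 𝔸] [FiniteDimensional ℂ 𝔸]
  {W : Type*} [NormedAddCommGroup W] [InnerProductSpace ℂ W] [FiniteDimensional ℂ W] (φ : W ≃ₗ[ℂ] 𝔸) {a' Mφ Mφ' : ℝ}
  (hMφ : 0 ≤ Mφ) (hMφ' : 0 ≤ Mφ') (hφn : ∀ w, ‖φ w‖ ≤ Mφ * ‖w‖) (hφn' : ∀ X, ‖φ.symm X‖ ≤ Mφ' * ‖X‖) (ha' : 0 < a')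
  {r : ℝ} (hr0 : 0 ≤ r) (hr1 : r < 1)
  (τ : 𝔸 →ₗ[ℂ] ℂ) (hτ₂ : ∀ X Y : 𝔸, τ (X * Y) = τ (Y * X)) (hφτ : ∀ X Y : 𝔸, ⟪φ.symm X, φ.symm Y⟫_ℂ = τ (star X * Y))
  {ι : Type} [Fintype ι] [DecidableEq ι] (b : Module.Basis ι ℝ 𝔸) {M₂ : ℝ} (hM₂ : 0 ≤ M₂) (hrepr : ∀ (v : 𝔸) (i : ι), |b.repr v i| ≤ M₂ * ‖v‖)

include hMφ hMφ' hφn hφn' ha' hr0 hr1 hτ₂ hφτ hM₂ hrepr in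
/-- **THE TWO-BACKGROUND LADDER FOR `R_k`, GIVEN THE INVERSE THIRD OPERATOR's ROWS AND LADDER** (see the module docstring).
[cite: Balaban1985BackgroundPropagators, (3.68) p.403, (3.25) p.394, Thm 3.1 (3.42) p.397, Thm 3.2 (3.48) p.398; Balaban1984PropagatorsII, (2.51)–(2.55) p.232, (2.66) p.234] -/
theorem exists_hasMajorant_RofUk_sub_flat (hd : 1 ≤ d) (hL3 : 3 ≤ L) {Kc δc KD δD : ℝ} (hKc : 0 ≤ Kc) (hδc : 0 < δc) (hKD : 0 ≤ KD) (hδD : 0 < δD) :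
    ∃ αR K δ : ℝ, 0 < αR ∧ 0 ≤ K ∧ 0 < δ ∧
      ∀ (n : ℕ) (η : ℝ), η * (L : ℝ) ^ (n + 1) = 1 →
      ∀ (c₀ c₁ : ℝ) [Fact (0 < c₀)] [Fact (0 < c₁)], c₀ * ((L : ℝ) ^ (n + 1)) ^ d = c₁ →
      ∀ (m : Fin d → ℕ) [∀ i, NeZero (m i)] (U : Bond d (towerP L m (n + 1)) → 𝔸ˣ) (α : ℝ), 0 ≤ α → α ≤ αR →
        (∀ bd, U bd ∈ U1 𝔸) → (∀ bd, ‖(U bd : 𝔸) - 1‖ ≤ α * η) →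
        (∀ (x : TSite d (towerP L m (n + 1))) (μ ν : Fin d), ‖(U (shift ν x, μ) : 𝔸) - (U (x, μ) : 𝔸)‖ ≤ α * η ^ 2) →
      ∀ (hUst : ∀ bd, star (U bd : 𝔸) = (((U bd)⁻¹ : 𝔸ˣ) : 𝔸))
        (εU : ℕ → ℝ), (∀ j, 0 ≤ εU j) → (∀ j, εU j ≤ 1) → (∀ j < n + 1, εU j ≤ α * r ^ j) →
        (∀ (j : ℕ) (bd : Bond d (towerP L m (j + 1))), ‖(UlevOf L m (n + 1) U j bd : 𝔸) - 1‖ ≤ εU j) →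
        (∀ (j : ℕ) (bd : Bond d (towerP L m (j + 1))), UlevOf L m (n + 1) U j bd ∈ U1 𝔸) →
        (∀ (j : ℕ) (bd : Bond d (towerP L m (j + 1))) (w : W), ‖adTransportW φ (UlevOf L m (n + 1) U j) bd w‖ ≤ ‖w‖) →
      ∀ (hposU : ∀ x : SiteL2K ℂ d (towerP L m (n + 1)) c₀ W, x ≠ 0 → 0 < RCLike.re ⟪x, laplacePrimeAk L m n φ η U a' (c₁ := c₁) x⟫_ℂ)
        (hpos₁ : ∀ x : SiteL2K ℂ d (towerP L m (n + 1)) c₀ W, x ≠ 0 →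
          0 < RCLike.re ⟪x, laplacePrimeAk L m n φ η (fun _ : Bond d (towerP L m (n + 1)) => (1 : 𝔸ˣ)) a' (c₁ := c₁) x⟫_ℂ)
        (M Rr : ℝ) (H : Prop),
        HasMajorant (g := toB6 (towerGeom L m n η M) Rr H) (fun q : TSite d m × ι => q.1) (conj b (readA φ (greenK _ (QGGQk_pos L m n φ c₀ η U c₁ a' (adTransportW_adjoint φ τ hτ₂ hUst hφτ) hposU)))) (fun a a'' => Kc * Real.exp (-(δc * (towerGeom L m n η M).dist a a''))) →
        HasMajorant (g := toB6 (towerGeom L m n η M) Rr H) (fun q : TSite d m × ι => q.1) (conj b (readA φ (greenK _ (QGGQk_pos L m n φ c₀ η (fun _ : Bond d (towerP L m (n + 1)) => (1 : 𝔸ˣ)) c₁ a' (adTransportW_adjoint φ τ hτ₂ (star_one_eq_inv_one L m n) hφτ) hpos₁)))) (fun a a'' => Kc * Real.exp (-(δc * (towerGeom L m n η M).dist a a''))) →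
        HasMajorant (g := toB6 (towerGeom L m n η M) Rr H) (fun q : TSite d m × ι => q.1) (conj b (readA φ (greenK _ (QGGQk_pos L m n φ c₀ η U c₁ a' (adTransportW_adjoint φ τ hτ₂ hUst hφτ) hposU))) - conj b (readA φ (greenK _ (QGGQk_pos L m n φ c₀ η (fun _ : Bond d (towerP L m (n + 1)) => (1 : 𝔸ˣ)) c₁ a' (adTransportW_adjoint φ τ hτ₂ (star_one_eq_inv_one L m n) hφτ) hpos₁))))
          (fun a a'' => KD * α * Real.exp (-(δD * (towerGeom L m n η M).dist a a''))) →
      HasMajorant (g := toB6 (towerGeom L m n η M) Rr H) (fun p : TSite d (towerP L m (n + 1)) × ι => blkK L m n p.1)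
        (conj b (readA φ (RofUk L m n φ η U (c₀ := c₀))) - conj b (readA φ (RofUk L m n φ η (fun _ : Bond d (towerP L m (n + 1)) => (1 : 𝔸ˣ)) (c₀ := c₀))))
        (fun a a'' => K * α * Real.exp (-(δ * (towerGeom L m n η M).dist a a''))) := by
  obtain ⟨αJ, BJ, δJ, hαJ, hBJ, hδJ, Hlad⟩ :=
    exists_hasMajorant_GpOfUk_sub_flat L φ hMφ hMφ' hφn hφn' ha' hr0 hr1 τ hτ₂ hφτ b hM₂ hrepr hd hL3
  obtain ⟨BG, δ₀, hBG, hδ₀, hbase⟩ := exists_hasMajorants_GpOfUk_one L φ (a' := a') hMφ hMφ' hφn hφn' ha' τ hτ₂ hφτ b hM₂ hrepr hd hL3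
  -- the lattice-free constants
  have hSb : 0 ≤ ∑ i, ‖b i‖ := Finset.sum_nonneg fun i _ => norm_nonneg _
  set κ : ℝ := M₂ * ∑ i, ‖b i‖ with hκ
  have hκ0 : 0 ≤ κ := mul_nonneg hM₂ hSb
  set ck : ℝ := ((d * (L - 1) : ℕ) : ℝ) * (3 / (1 - r)) with hck
  have hck0 : 0 ≤ ck := mul_nonneg (Nat.cast_nonneg _) (div_nonneg (by norm_num) (by linarith))
  set cs : ℝ := ((d * (L - 1) : ℕ) : ℝ) * (2 * Mφ * Mφ' / (1 - r)) with hcs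
  have hcs0 : 0 ≤ cs := mul_nonneg (Nat.cast_nonneg _) (div_nonneg (by positivity) (by linarith))
  set cKF : ℝ := ck * Real.exp (ck * (1 / 16)) with hcKF
  set cSF : ℝ := Mφ * Mφ' * (cs * Real.exp (cs * (1 / 16))) with hcSF
  have hcKF0 : 0 ≤ cKF := by rw [hcKF]; positivity
  have hcSF0 : 0 ≤ cSF := by rw [hcSF]; positivity
  set δm : ℝ := min (min δ₀ δJ) (min δc δD) with hδm
  have hδm0 : 0 < δm := lt_min (lt_min hδ₀ hδJ) (lt_min hδc hδD)
  have hδm₀ : δm ≤ δ₀ := (min_le_left _ _).trans (min_le_left _ _)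
  have hδmJ : δm ≤ δJ := (min_le_left _ _).trans (min_le_right _ _)
  have hδmc : δm ≤ δc := (min_le_right _ _).trans (min_le_left _ _)
  have hδmD : δm ≤ δD := (min_le_right _ _).trans (min_le_right _ _)
  set αR : ℝ := min αJ (1 / 16) with hαR
  have hc1h : 0 ≤ B6.c1 d δm (1 / 2) := c1_nonneg d _ _
  refine ⟨αR, B6.c1 d δm (1 / 2) * B6.c1 d δm (1 / 2) *
      (BJ * (Mφ * Mφ' * κ) * Kc * (1 * κ) * (BG + BJ * αR) + BG * (cSF * κ) * Kc * (1 * κ) * (BG + BJ * αR) +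
        BG * (Mφ * Mφ' * κ) * KD * (1 * κ) * (BG + BJ * αR) + BG * (Mφ * Mφ' * κ) * Kc * (cKF * κ) * (BG + BJ * αR) +
          BG * (Mφ * Mφ' * κ) * Kc * (1 * κ) * BJ), δm / 2,
    lt_min hαJ (by norm_num), by positivity, by linarith, ?_⟩
  intro n η hη c₀ c₁ _ _ hc m _ U α hα0 hαle hU1 hUs hUw hUst εU hε0 hε1 hεr hlev hlev1 hRlev hposU hpos₁ M Rr H hcU hc1 hcD
  have hαJ' : α ≤ αJ := hαle.trans (min_le_left _ _)
  have hα16 : α ≤ 1 / 16 := hαle.trans (min_le_right _ _)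
  have hD := Hlad n η hη c₀ c₁ hc m U α hα0 hαJ' hU1 hUs hUw εU hε0 hε1 hεr hlev hlev1 hposU hpos₁ M Rr H
  have hF := (hbase n η hη c₀ c₁ hc m hpos₁ M Rr H).1
  have hlen1 : ∀ a : (towerGeom L m n η M).Site, (towerGeom L m n η M).len a = 1 := fun a => by
    rw [len_towerGeom, mul_comm]; exact hη
  have hdnn := hdnn_towerGeom L m n η M
  have hc₀ : (0 : ℝ) < c₀ := Fact.out
  have hLp : ((L : ℝ) ^ (n + 1)) ^ d ≠ 0 := pow_ne_zero _ (pow_ne_zero _ (Nat.cast_ne_zero.mpr (NeZero.ne L)))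
  have hw1 : (c₁ / c₀) * (((L : ℝ) ^ (n + 1)) ^ d)⁻¹ = 1 := by rw [← hc]; field_simp
  -- (1) the fine factors at the common rate
  have hF' : HasMajorant (g := toB6 (towerGeom L m n η M) Rr H) (fun p : TSite d (towerP L m (n + 1)) × ι => blkK L m n p.1) (conj b (readA φ (GpOfUk L m n φ η (fun _ : Bond d (towerP L m (n + 1)) => (1 : 𝔸ˣ)) a' (c₁ := c₁) hpos₁))) (fun a a'' => BG * Real.exp (-(δm * (towerGeom L m n η M).dist a a''))) :=
    hasMajorant_mono _ hF fun a a'' => by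
      rw [hlen1 a, one_pow, mul_one]
      exact weaken hBG.le le_rfl hδm₀ (hdnn a a'')
  have hEF' : HasMajorant (g := toB6 (towerGeom L m n η M) Rr H) (fun p : TSite d (towerP L m (n + 1)) × ι => blkK L m n p.1)
      (conj b (readA φ (GpOfUk L m n φ η U a' (c₁ := c₁) hposU)) - conj b (readA φ (GpOfUk L m n φ η (fun _ : Bond d (towerP L m (n + 1)) => (1 : 𝔸ˣ)) a' (c₁ := c₁) hpos₁)))
      (fun a a'' => BJ * α * Real.exp (-(δm * (towerGeom L m n η M).dist a a''))) :=
    hasMajorant_mono _ hD fun a a'' => weaken (mul_nonneg hBJ hα0) le_rfl hδmJ (hdnn a a'')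
  -- (2) the coarse factors at the common rate
  have hcU' : HasMajorant (g := toB6 (towerGeom L m n η M) Rr H) (fun q : TSite d m × ι => q.1) (conj b (readA φ (greenK _ (QGGQk_pos L m n φ c₀ η U c₁ a' (adTransportW_adjoint φ τ hτ₂ hUst hφτ) hposU)))) (fun a a'' => Kc * Real.exp (-(δm * (towerGeom L m n η M).dist a a''))) :=
    hasMajorant_mono _ hcU fun a a'' => weaken hKc le_rfl hδmc (hdnn a a'')
  have hc1' : HasMajorant (g := toB6 (towerGeom L m n η M) Rr H) (fun q : TSite d m × ι => q.1) (conj b (readA φ (greenK _ (QGGQk_pos L m n φ c₀ η (fun _ : Bond d (towerP L m (n + 1)) => (1 : 𝔸ˣ)) c₁ a' (adTransportW_adjoint φ τ hτ₂ (star_one_eq_inv_one L m n) hφτ) hpos₁)))) (fun a a'' => Kc * Real.exp (-(δm * (towerGeom L m n η M).dist a a''))) :=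
    hasMajorant_mono _ hc1 fun a a'' => weaken hKc le_rfl hδmc (hdnn a a'')
  have hcD' : HasMajorant (g := toB6 (towerGeom L m n η M) Rr H) (fun q : TSite d m × ι => q.1) (conj b (readA φ (greenK _ (QGGQk_pos L m n φ c₀ η U c₁ a' (adTransportW_adjoint φ τ hτ₂ hUst hφτ) hposU))) - conj b (readA φ (greenK _ (QGGQk_pos L m n φ c₀ η (fun _ : Bond d (towerP L m (n + 1)) => (1 : 𝔸ˣ)) c₁ a' (adTransportW_adjoint φ τ hτ₂ (star_one_eq_inv_one L m n) hφτ) hpos₁))))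
      (fun a a'' => KD * α * Real.exp (-(δm * (towerGeom L m n η M).dist a a''))) :=
    hasMajorant_mono _ hcD fun a a'' => weaken (mul_nonneg hKD hα0) le_rfl hδmD (hdnn a a'')
  -- (3) the block-diagonal letters (as in `B9Eq365TowerXOperatorLadder`)
  have hkF : ∀ y x, blkK L m n x = y →
      ‖((kQ L m n (fun j => adTransport (𝕜 := ℂ) (UlevOf L m (n + 1) U j))) - kQ L m n (fun _ _ => (LinearMap.id : 𝔸 →ₗ[ℂ] 𝔸))) y x‖ ≤ cKF * α * (((L : ℝ) ^ (n + 1)) ^ d)⁻¹ := fun y x _ => by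
    refine (norm_kF_le_of_class L m n U εU hε0 hε1 hlev hlev1 hr0 hr1 hα0 hεr y x).trans ?_
    have e1 : ((d * (L - 1) : ℕ) : ℝ) * (3 * α / (1 - r)) = ck * α := by rw [hck]; ring
    rw [e1, hcKF]
    exact mul_le_mul_of_nonneg_right (exp_window_sub_one_le hck0 hα0 hα16) (by positivity)
  have hker : conjHom b (kerOp (blkK L m n) (kQ L m n (fun j => adTransport (𝕜 := ℂ) (UlevOf L m (n + 1) U j)))) - conjHom b (kerOp (blkK L m n) (kQ L m n (fun j => adTransport (𝕜 := ℂ) (UlevOf L m (n + 1) (fun _ : Bond d (towerP L m (n + 1)) => (1 : 𝔸ˣ)) j)))) =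
      conjHom b (kerOp (blkK L m n) ((kQ L m n (fun j => adTransport (𝕜 := ℂ) (UlevOf L m (n + 1) U j))) - kQ L m n (fun _ _ => (LinearMap.id : 𝔸 →ₗ[ℂ] 𝔸)))) := by
    rw [← conjHom_sub, kQ_flatLevels_eq]
    refine congrArg (conjHom b) (LinearMap.ext fun μ => ?_)
    rw [LinearMap.sub_apply, sub_eq_iff_eq_add, ← kerOp_add_kernel, sub_add_cancel]
  have hA : HasMajorantHom (g := toB6 (towerGeom L m n η M) Rr H) (fun p : TSite d (towerP L m (n + 1)) × ι => blkK L m n p.1) (fun q : TSite d m × ι => q.1)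
      (conjHom b (kerOp (blkK L m n) (kQ L m n (fun j => adTransport (𝕜 := ℂ) (UlevOf L m (n + 1) U j)))) - conjHom b (kerOp (blkK L m n) (kQ L m n (fun j => adTransport (𝕜 := ℂ) (UlevOf L m (n + 1) (fun _ : Bond d (towerP L m (n + 1)) => (1 : 𝔸ˣ)) j)))))
      (fun a a'' : TSite d m => if a = a'' then cKF * κ * α else 0) := by
    rw [hker]
    exact hasMajorantHom_mono _ _ (hasMajorantHom_kerOp_ind L m n η M b hM₂ hrepr Rr H _ (mul_nonneg hcKF0 hα0) hkF)
      fun a a'' => le_of_eq (by split_ifs <;> ring)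
  have hAU : HasMajorantHom (g := toB6 (towerGeom L m n η M) Rr H) (fun p : TSite d (towerP L m (n + 1)) × ι => blkK L m n p.1) (fun q : TSite d m × ι => q.1) (conjHom b (kerOp (blkK L m n) (kQ L m n (fun j => adTransport (𝕜 := ℂ) (UlevOf L m (n + 1) U j))))) (fun a a'' : TSite d m => if a = a'' then 1 * κ else 0) :=
    hasMajorantHom_kerOp_ind L m n η M b hM₂ hrepr Rr H _ zero_le_one fun y x _ => by
      rw [one_mul]
      exact norm_kQ_le L m n _ (fun j bd v => B9Eq357QprimeTowerKernelForm.norm_adTransport_le_of_norm_le_one _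
        (fun bd' => (B7Prop1Explicit.mem_U1).1 (hlev1 j bd')) bd v) y x
  have hA1 : HasMajorantHom (g := toB6 (towerGeom L m n η M) Rr H) (fun p : TSite d (towerP L m (n + 1)) × ι => blkK L m n p.1) (fun q : TSite d m × ι => q.1) (conjHom b (kerOp (blkK L m n) (kQ L m n (fun j => adTransport (𝕜 := ℂ) (UlevOf L m (n + 1) (fun _ : Bond d (towerP L m (n + 1)) => (1 : 𝔸ˣ)) j))))) (fun a a'' : TSite d m => if a = a'' then 1 * κ else 0) := by
    rw [kQ_flatLevels_eq]
    exact hasMajorantHom_kerOp_ind L m n η M b hM₂ hrepr Rr H _ zero_le_one fun y x _ => by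
      rw [one_mul]; exact norm_kQ_le L m n _ (fun _ _ v => le_rfl) y x
  have hsU : ∀ x, ‖(sQ L m n φ U (c₀ := c₀) (c₁ := c₁)) x‖ ≤ Mφ * Mφ' := fun x =>
    (norm_sQ_le L m n φ (c₀ := c₀) (c₁ := c₁) U hMφ hMφ' hφn hφn' hRlev x).trans (le_of_eq (by rw [hw1, mul_one]))
  have hs1 : ∀ x, ‖(sQ L m n φ (fun _ : Bond d (towerP L m (n + 1)) => (1 : 𝔸ˣ)) (c₀ := c₀) (c₁ := c₁)) x‖ ≤ Mφ * Mφ' := fun x =>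
    (norm_sQ_le L m n φ (c₀ := c₀) (c₁ := c₁) (fun _ : Bond d (towerP L m (n + 1)) => (1 : 𝔸ˣ)) hMφ hMφ' hφn hφn' (norm_adTransportW_UlevOf_one_le L m n φ) x).trans (le_of_eq (by rw [hw1, mul_one]))
  have hSU : HasMajorantHom (g := toB6 (towerGeom L m n η M) Rr H) (fun q : TSite d m × ι => q.1) (fun p : TSite d (towerP L m (n + 1)) × ι => blkK L m n p.1) (conjHom b (liftOp (blkK L m n) (sQ L m n φ U (c₀ := c₀) (c₁ := c₁)))) (fun a a'' : TSite d m => if a = a'' then Mφ * Mφ' * κ else 0) :=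
    hasMajorantHom_liftOp_ind L m n η M b hM₂ hrepr Rr H _ (mul_nonneg hMφ hMφ') hsU
  have hS1 : HasMajorantHom (g := toB6 (towerGeom L m n η M) Rr H) (fun q : TSite d m × ι => q.1) (fun p : TSite d (towerP L m (n + 1)) × ι => blkK L m n p.1) (conjHom b (liftOp (blkK L m n) (sQ L m n φ (fun _ : Bond d (towerP L m (n + 1)) => (1 : 𝔸ˣ)) (c₀ := c₀) (c₁ := c₁)))) (fun a a'' : TSite d m => if a = a'' then Mφ * Mφ' * κ else 0) :=
    hasMajorantHom_liftOp_ind L m n η M b hM₂ hrepr Rr H _ (mul_nonneg hMφ hMφ') hs1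
  have hsF : ∀ x, ‖((sQ L m n φ U (c₀ := c₀) (c₁ := c₁)) - (sQ L m n φ (fun _ : Bond d (towerP L m (n + 1)) => (1 : 𝔸ˣ)) (c₀ := c₀) (c₁ := c₁))) x‖ ≤ cSF * α := fun x => by
    rw [Pi.sub_apply]
    refine (norm_sF_le_of_class L m n φ U εU hε0 hlev hlev1 hr0 hr1 hα0 hεr hMφ hMφ' hφn hφn' x).trans ?_
    have e1 : ((d * (L - 1) : ℕ) : ℝ) * (2 * Mφ * Mφ' * α / (1 - r)) = cs * α := by rw [hcs]; ring
    rw [e1]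
    have hexp := exp_window_sub_one_le hcs0 hα0 hα16
    calc Mφ * Mφ' * ((c₁ / c₀) * ((Real.exp (cs * α) - 1) * (((L : ℝ) ^ (n + 1)) ^ d)⁻¹))
          = Mφ * Mφ' * (Real.exp (cs * α) - 1) * ((c₁ / c₀) * (((L : ℝ) ^ (n + 1)) ^ d)⁻¹) := by ring
      _ = Mφ * Mφ' * (Real.exp (cs * α) - 1) := by rw [hw1, mul_one]
      _ ≤ Mφ * Mφ' * (cs * Real.exp (cs * (1 / 16)) * α) := mul_le_mul_of_nonneg_left hexp (mul_nonneg hMφ hMφ')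
      _ = cSF * α := by rw [hcSF]; ring
  have hlift : conjHom b (liftOp (blkK L m n) (sQ L m n φ U (c₀ := c₀) (c₁ := c₁))) - conjHom b (liftOp (blkK L m n) (sQ L m n φ (fun _ : Bond d (towerP L m (n + 1)) => (1 : 𝔸ˣ)) (c₀ := c₀) (c₁ := c₁))) =
      conjHom b (liftOp (blkK L m n) ((sQ L m n φ U (c₀ := c₀) (c₁ := c₁)) - (sQ L m n φ (fun _ : Bond d (towerP L m (n + 1)) => (1 : 𝔸ˣ)) (c₀ := c₀) (c₁ := c₁)))) := by
    rw [← conjHom_sub]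
    refine congrArg (conjHom b) (LinearMap.ext fun ν => funext fun x => ?_)
    rw [LinearMap.sub_apply, Pi.sub_apply, liftOp_apply, liftOp_apply, liftOp_apply, Pi.sub_apply, sub_apply]
  have hS : HasMajorantHom (g := toB6 (towerGeom L m n η M) Rr H) (fun q : TSite d m × ι => q.1) (fun p : TSite d (towerP L m (n + 1)) × ι => blkK L m n p.1)
      (conjHom b (liftOp (blkK L m n) (sQ L m n φ U (c₀ := c₀) (c₁ := c₁))) - conjHom b (liftOp (blkK L m n) (sQ L m n φ (fun _ : Bond d (towerP L m (n + 1)) => (1 : 𝔸ˣ)) (c₀ := c₀) (c₁ := c₁))))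
      (fun a a'' : TSite d m => if a = a'' then cSF * κ * α else 0) := by
    rw [hlift]
    exact hasMajorantHom_mono _ _ (hasMajorantHom_liftOp_ind L m n η M b hM₂ hrepr Rr H _ (mul_nonneg hcSF0 hα0) hsF)
      fun a a'' => le_of_eq (by split_ifs <;> ring)
  -- (4) the words and the abstract ladder
  rw [conj_readA_RofUk_eq L m n φ η U a' (adTransportW_adjoint φ τ hτ₂ hUst hφτ) hposU b, conj_readA_RofUk_eq L m n φ η (fun _ : Bond d (towerP L m (n + 1)) => (1 : 𝔸ˣ)) a' (adTransportW_adjoint φ τ hτ₂ (star_one_eq_inv_one L m n) hφτ) hpos₁ b, sub_sub_sub_cancel_left]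
  have hW := hasMajorant_word5_sub_word5 L m n η M Rr H (fun p : TSite d (towerP L m (n + 1)) × ι => blkK L m n p.1) (fun q : TSite d m × ι => q.1) hBG.le hBJ (by positivity) (mul_nonneg hcSF0 hκ0) hKc hKD (by positivity)
    (mul_nonneg hcKF0 hκ0) hα0 hαle hδm0 hF' hEF' hSU hS1 hS hcU' hc1' hcD' hAU hA1 hA
  have hW' := hasMajorant_neg (g := toB6 (towerGeom L m n η M) Rr H) _ hW
  rw [neg_sub] at hW'
  refine hasMajorant_mono _ hW' fun a a'' => le_of_eq ?_
  ring

end Main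

end Literature.MathematicalPhysics.QuantumFieldTheory.Balaban1983to89.B9Eq368TowerProjLadder

end
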